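import Summits.CriticalPhenomena.CardyFormulaZ2.Theorems.CardyMagicRigidityNestingRigidityUVCollarScales
import Summits.CriticalPhenomena.CardyFormulaZ2.Theorems.CardyMagicRigidityNestingRigidityUVExpMomentsChargeFree
import HarnessLib

/-!
# Crux `NestingRigidity`, line `positive-cone-weight-doubling`: stub K — ALL-ORDER exponential
# moments of the COLLAR STATISTIC of the cone cloud, both lattices (`uvCollar_expMoment_latticeEnsembles`)

Crux `Summit.CriticalPhenomena.CardyFormulaZ2.Theses.CardyMagicRigidity.NestingRigidity`
(stmt-CriticalPhenomena-4835), line `positive-cone-weight-doubling`, registered helper K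
`uvCollar_expMoment_latticeEnsembles` toward the shared stub `stub_uvDecoupling` (input (K) of
`uvExpMoments_of_chargeFree_bounds`, …UVExpMomentsChargeFree): for `E ∈ latticeEnsembles` and every
order `a > 0` there are `C, r₀ > 0` such that for every `r ∈ (0, r₀)`, for all small meshes,
`E_δ exp(a K) ≤ C`, `K = Σ_{u ∈ C_r} φ_u + #X + Σ_{u ∈ C_1} ψ_u` the collar statistic of
`abs_uvPhaseBd_le_collar_latticeEnsembles` (`C_r` = inner-collar crossers, `X` = exit loops,
`C_1` = outer-collar crossers; `φ_u`, `ψ_u` the disc and ring fractions of the bite), uniformly in `r`.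

* §1 EXIT LOOPS at general radii (registered-form brick `expMoment_exitCount_le_latticeEnsembles`):
  a loop surrounding `B̄(0, ρ)`, leaving `B(0, R)` and meeting `B̄(0, R + 2δ)` passes through the
  collar `R ≤ |z| ≤ R + 2δ` and is not inside any ball `B(x, R)` with `|x| = R + 2δ` (it surrounds
  `0`), so the aspect-dependent count bound `expMoment_collarCount_le_latticeEnsembles` with cells of
  size `R/K` gives `E_δ e^{t #X} ≤ exp(2 e^{2t} (8πK + 3))` for `K c₀ δ ≤ R`, all orders `t`;
* §2 the registered statement: `φ_u ≤ min(1, diam²/r²)` on `C_r` and `ψ_u ≤ min(1, diam²)` on `C_1`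
  (`TiltTransfer.discFrac_le_diam_sq_div`, `…ringFrac_le_diam_sq_div`), so the two collar sums are
  dominated by the collar-crosser statistics of `expMoment_collarStat_le_latticeEnsembles` at
  `(ρ₁, ρ₂, ρ') = (r − 2δ, r, r)` and `(1, 1 + 2δ, 1)`; generalised Hölder with weights `1/3`
  (`expMoment_sum_le_prod_latticeEnsembles`) assembles the three pieces at the order `3a`.
No cited fact, no definition.
-/

noncomputable section

open MeasureTheory Set Filter Metric
open scoped Real Topology BigOperators ENNReal

namespace Summit.CriticalPhenomena.CardyFormulaZ2.Cruxes.NestingRigidity.PositiveConeWeightDoubling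

open Literature.Probability.RandomPlanarGeometry Literature.Probability.Percolation
  Literature.Probability.LatticeModels
open Summit.CriticalPhenomena.CardyFormulaZ2.Cruxes.NestingRigidity.RingCloudTomography

namespace UVCollar

/-! ## §1 Exit loops -/

/-- **All-order exponential moments of the number of exit loops, both lattices, general radii**:
for `E ∈ latticeEnsembles` and `t > 0` there are `C`, `c > 0` with
`E_δ exp(t #{u ∈ X_δ : B̄(0,ρ) ⊆ int u, trace u ⊄ B(0,R), trace u ∩ B̄(0, R + 2δ) ≠ ∅}) ≤ C` for all
`δ > 0`, `c δ ≤ R`, `ρ ≥ 0` (integrability included). -/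
theorem expMoment_exitCount_le : ∀ E ∈ latticeEnsembles, ∀ {t : ℝ}, 0 < t → ∃ C c : ℝ, 0 < c ∧
    ∀ (δ ρ R : ℝ), 0 < δ → c * δ ≤ R → 0 ≤ ρ →
      Integrable (fun ω ↦ Real.exp (t * ({u ∈ (E.X δ ω).loops | closedBall (0 : ℂ) ρ ⊆ {z | u.wind z ≠ 0} ∧
        ¬ u.range ⊆ ball (0 : ℂ) R ∧ (u.range ∩ closedBall (0 : ℂ) (R + 2 * δ)).Nonempty}.ncard : ℝ))) E.P ∧
      ∫ ω, Real.exp (t * ({u ∈ (E.X δ ω).loops | closedBall (0 : ℂ) ρ ⊆ {z | u.wind z ≠ 0} ∧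
        ¬ u.range ⊆ ball (0 : ℂ) R ∧ (u.range ∩ closedBall (0 : ℂ) (R + 2 * δ)).Nonempty}.ncard : ℝ)) ∂E.P ≤ C := by
  intro E hE t ht
  obtain ⟨α, c₀, hα, hc₀4, hCT⟩ := expMoment_collarCount_le_latticeEnsembles E hE
  have hc₀ : 0 < c₀ := by linarith
  obtain ⟨K, hK8, hKw⟩ := TowerMomentUpper.exists_aspect (w := Real.exp t) (Real.one_le_exp ht.le) hα
  have hK8' : (8 : ℝ) ≤ K := by exact_mod_cast hK8
  have hK0 : (0 : ℝ) < K := by linarith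
  set p : ℝ := (4 / (K : ℝ)) ^ α with hp
  have hp0 : 0 ≤ p := by positivity
  have hp1 : p ≤ 1 := by
    have : Real.exp t ^ 2 * p ≤ 1 / 2 := hKw
    nlinarith [Real.one_le_exp ht.le, one_le_pow₀ (Real.one_le_exp ht.le) (n := 2)]
  have hq : Real.exp (2 * t) * p ≤ 1 / 2 := by
    have e : Real.exp t ^ 2 = Real.exp (2 * t) := by rw [← Real.exp_nat_mul]; ring_nf
    rw [← e]; exact hKw
  refine ⟨Real.exp (2 * Real.exp (2 * t) * (8 * π * K + 3)), K * c₀, by positivity,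
    fun δ ρ R hδ hcR hρ ↦ ?_⟩
  have hR : 0 < R := lt_of_lt_of_le (by positivity) hcR
  have h4K : 4 * K * δ ≤ R := by
    have : 4 * (K : ℝ) * δ ≤ K * c₀ * δ := by
      nlinarith [mul_le_mul_of_nonneg_left hc₀4 (by positivity : (0 : ℝ) ≤ K * δ)]
    exact this.trans hcR
  have ha : c₀ * δ ≤ R / K := by rw [le_div_iff₀ hK0]; linarith
  have h2δ : 2 * δ ≤ R := by nlinarith [hδ.le]
  have hQ : ∀ u : UnbasedLoop ℂ, (closedBall (0 : ℂ) ρ ⊆ {z | u.wind z ≠ 0} ∧ ¬ u.range ⊆ ball (0 : ℂ) R ∧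
      (u.range ∩ closedBall (0 : ℂ) (R + 2 * δ)).Nonempty) →
      (∃ z ∈ u.range, (R + 2 * δ) - R / K / 2 ≤ ‖z‖ ∧ ‖z‖ ≤ R + 2 * δ) ∧
      ∀ x : ℂ, ‖x‖ = R + 2 * δ → (u.range ∩ (ball x (K * (R / K)))ᶜ).Nonempty := by
    intro u hu
    refine ⟨?_, fun x hx ↦ ?_⟩
    · obtain ⟨z, hz, hz1, hz2⟩ := exists_mem_range_norm_mem_Icc u (by linarith) hu.2.2 hu.2.1
      refine ⟨z, hz, ?_, hz2⟩
      have : 2 * δ ≤ R / K / 2 := by rw [le_div_iff₀ two_pos, le_div_iff₀ hK0]; linarith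
      linarith
    · have e : (K : ℝ) * (R / K) = R := by field_simp
      rw [e]
      exact TowerMomentUpper.range_inter_compl_ball_nonempty u hρ hu.1 (by rw [hx]; linarith)
  obtain ⟨hint, hle⟩ := hCT K δ (R + 2 * δ) (R / K) t _ hK8' hδ ha (by positivity) ht.le hq hQ
  refine ⟨hint, hle.trans (Real.exp_le_exp.2 ?_)⟩
  have h1 : 0 ≤ Real.exp (2 * t) - 1 := by linarith [Real.one_le_exp (by positivity : 0 ≤ 2 * t)]
  have hcells : 4 * π * (R + 2 * δ) / (R / K) + 3 ≤ 8 * π * K + 3 := by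
    have e : 4 * π * (R + 2 * δ) / (R / K) = 4 * π * K * ((R + 2 * δ) / R) := by field_simp
    rw [e]
    have hr : (R + 2 * δ) / R ≤ 2 := by rw [div_le_iff₀ hR]; linarith
    nlinarith [Real.pi_pos, mul_le_mul_of_nonneg_left hr (by positivity : 0 ≤ 4 * π * K)]
  have h2 : 2 * (Real.exp (2 * t) - 1) * p ≤ 2 * Real.exp (2 * t) := by nlinarith [Real.exp_pos (2 * t)]
  calc 2 * (Real.exp (2 * t) - 1) * p * (4 * π * (R + 2 * δ) / (R / K) + 3)
      ≤ 2 * (Real.exp (2 * t) - 1) * p * (8 * π * K + 3) :=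
        mul_le_mul_of_nonneg_left hcells (by positivity)
    _ ≤ 2 * Real.exp (2 * t) * (8 * π * K + 3) := mul_le_mul_of_nonneg_right h2 (by positivity)

/-! ## §2 The collar sums are dominated by the collar-crosser statistics -/

/-- **Termwise domination of a collar sum**: on a finite loop family `C`, if `0 ≤ g u ≤ min(1, diam²/ρ'²)`
for `u ∈ C`, then `Σ_{u ∈ C} g u ≤ Σ_{u ∈ C} min(1, diam(u)²/ρ'²)`. -/
theorem finsum_mem_le_finsum_min {C : Set (UnbasedLoop ℂ)} (hC : C.Finite) {g : UnbasedLoop ℂ → ℝ} {ρ' : ℝ}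
    (hg : ∀ u ∈ C, g u ≤ min 1 (diam u.range ^ 2 / ρ' ^ 2)) :
    ∑ᶠ u ∈ C, g u ≤ ∑ᶠ u ∈ C, min 1 (diam u.range ^ 2 / ρ' ^ 2) := by
  rw [finsum_mem_eq_finite_toFinset_sum _ hC, finsum_mem_eq_finite_toFinset_sum _ hC]
  exact Finset.sum_le_sum fun u hu ↦ hg u (hC.mem_toFinset.1 hu)

/-- The disc fraction of an inner-collar crosser is `≤ min(1, diam²/r²)`. -/
theorem discFrac_le_min (u : UnbasedLoop ℂ) {r : ℝ} (hr : 0 < r)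
    (hu : (u.range ∩ closedBall (0 : ℂ) r).Nonempty) :
    ∫ z in {z | u.wind z ≠ 0}, discDensity 0 r z ≤ min 1 (diam u.range ^ 2 / r ^ 2) := by
  obtain ⟨x, hx, -⟩ := hu
  exact le_min (ConeTilt.setIntegral_discDensity_mem_Icc 0 hr _).2 (TiltTransfer.discFrac_le_diam_sq_div u hr hx)

/-- The ring fraction of an outer-collar crosser is `≤ min(1, diam²/1²)`. -/
theorem ringFrac_le_min (u : UnbasedLoop ℂ) {R : ℝ} (hu : (u.range ∩ closedBall (0 : ℂ) R).Nonempty) :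
    ∫ z in {z | u.wind z ≠ 0}, annulusDensity 0 1 2 z ≤ min 1 (diam u.range ^ 2 / 1 ^ 2) := by
  obtain ⟨x, hx, -⟩ := hu
  refine le_min (ConeTilt.setIntegral_annulusDensity_mem_Icc 0 one_pos one_lt_two _).2 ?_
  rw [one_pow, div_one]
  have := TiltTransfer.ringFrac_le_diam_sq_div u hx
  nlinarith [sq_nonneg (diam u.range)]

/-- **Hölder with three equal weights**: if `E e^{3X_i} ≤ M` (`i = 0, 1, 2`, integrable) for
measurable `X_i` on a lattice ensemble, then `E e^{X_0 + X_1 + X_2} ≤ M`. -/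
theorem integral_exp_add_three_le : ∀ E ∈ latticeEnsembles, ∀ (X₀ X₁ X₂ : E.Ω → ℝ) {M : ℝ},
    Measurable X₀ → Measurable X₁ → Measurable X₂ →
    Integrable (fun ω ↦ Real.exp (3 * X₀ ω)) E.P → ∫ ω, Real.exp (3 * X₀ ω) ∂E.P ≤ M →
    Integrable (fun ω ↦ Real.exp (3 * X₁ ω)) E.P → ∫ ω, Real.exp (3 * X₁ ω) ∂E.P ≤ M →
    Integrable (fun ω ↦ Real.exp (3 * X₂ ω)) E.P → ∫ ω, Real.exp (3 * X₂ ω) ∂E.P ≤ M →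
    ∫ ω, Real.exp (X₀ ω + X₁ ω + X₂ ω) ∂E.P ≤ M := by
  intro E hE X₀ X₁ X₂ M hm₀ hm₁ hm₂ hi₀ hI₀ hi₁ hI₁ hi₂ hI₂
  set X : Fin 3 → E.Ω → ℝ := ![X₀, X₁, X₂] with hX
  have hdiv : ∀ i ω, X i ω / (1 / 3 : ℝ) = 3 * X i ω := fun i ω ↦ by ring
  have hXm : ∀ i ∈ (Finset.univ : Finset (Fin 3)), Measurable (X i) := by
    intro i _; fin_cases i <;> assumption
  have hint : ∀ i ∈ (Finset.univ : Finset (Fin 3)), Integrable (fun ω ↦ Real.exp (X i ω / (1 / 3 : ℝ))) E.P := by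
    intro i _; simp_rw [hdiv]; fin_cases i <;> assumption
  have hIi : ∀ i : Fin 3, ∫ ω, Real.exp (X i ω / (1 / 3 : ℝ)) ∂E.P ≤ M := by
    intro i; simp_rw [hdiv]; fin_cases i <;> assumption
  obtain ⟨-, hle⟩ := expMoment_sum_le_prod_latticeEnsembles E hE (Fin 3) Finset.univ X (fun _ ↦ 1 / 3)
    (fun _ _ ↦ by norm_num) (by simp) hXm hint
  have hM0 : 0 ≤ M := (integral_nonneg fun ω ↦ (Real.exp_pos _).le).trans hI₀
  have hsum : ∀ ω, ∑ i, X i ω = X₀ ω + X₁ ω + X₂ ω := fun ω ↦ by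
    rw [Fin.sum_univ_three]; rfl
  simp_rw [hsum] at hle
  refine hle.trans ?_
  calc ∏ i, (∫ ω, Real.exp (X i ω / (1 / 3)) ∂E.P) ^ (1 / 3 : ℝ) ≤ ∏ _i : Fin 3, M ^ (1 / 3 : ℝ) :=
        Finset.prod_le_prod (fun i _ ↦ Real.rpow_nonneg (integral_nonneg fun ω ↦ (Real.exp_pos _).le) _)
          fun i _ ↦ Real.rpow_le_rpow (integral_nonneg fun ω ↦ (Real.exp_pos _).le) (hIi i) (by norm_num)
    _ = M := by
        rw [Finset.prod_const, Finset.card_univ, Fintype.card_fin, ← Real.rpow_natCast,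
          ← Real.rpow_mul hM0]
        norm_num

end UVCollar

/-! ## §3 The registered statements -/

/-- **Exit loops, registered form (helper toward K `uvCollar_expMoment_latticeEnsembles`; general radii,
reusable by the staircase of line `ring-cloud-tomography`).**  For `E ∈ latticeEnsembles` and every
order `t > 0` there are `C` and `c > 0` such that for all `δ > 0`, `R ≥ c δ`, `ρ ≥ 0`: the number of
loops of `X_δ` surrounding `B̄(0, ρ)`, leaving `B(0, R)` and meeting `B̄(0, R + 2δ)` has
`E_δ e^{t #} ≤ C` (thin cells of size `R/K` on the circle `|x| = R + 2δ`, one BK product, Poissonian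
summation: `UVCollar.expMoment_exitCount_le`). -/
theorem expMoment_exitCount_le_latticeEnsembles : ∀ E ∈ latticeEnsembles, ∀ t : ℝ, 0 < t → ∃ C c : ℝ, 0 < c ∧ ∀ (δ ρ R : ℝ), 0 < δ → c * δ ≤ R → 0 ≤ ρ → Integrable (fun ω ↦ Real.exp (t * ({u ∈ (E.X δ ω).loops | Metric.closedBall (0 : ℂ) ρ ⊆ {z | u.wind z ≠ 0} ∧ ¬ u.range ⊆ Metric.ball (0 : ℂ) R ∧ (u.range ∩ Metric.closedBall (0 : ℂ) (R + 2 * δ)).Nonempty}.ncard : ℝ))) E.P ∧ ∫ ω, Real.exp (t * ({u ∈ (E.X δ ω).loops | Metric.closedBall (0 : ℂ) ρ ⊆ {z | u.wind z ≠ 0} ∧ ¬ u.range ⊆ Metric.ball (0 : ℂ) R ∧ (u.range ∩ Metric.closedBall (0 : ℂ) (R + 2 * δ)).Nonempty}.ncard : ℝ)) ∂E.P ≤ C := by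
  intro E hE t ht
  exact UVCollar.expMoment_exitCount_le E hE ht

/-- **K · All-order exponential moments of the collar statistic of the cone cloud, both lattices**
(registered helper toward the shared stub `stub_uvDecoupling`, line `positive-cone-weight-doubling`;
input (K) of `uvExpMoments_of_chargeFree_bounds`).  For `E ∈ latticeEnsembles` and every `a > 0`
there are `C`, `r₀ > 0` such that for every `r ∈ (0, r₀)`, for all small meshes `δ`,
`E_δ exp(a (Σ_{u ∈ C_r} φ_u + #X + Σ_{u ∈ C_1} ψ_u)) ≤ C`, with `C_r` the loops meeting `B̄(0, r)` and
leaving `B(0, r − 2δ)`, `X` the exit loops (surrounding `B̄(0,r)`, leaving `B(0,1)`, meeting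
`B̄(0, 1+2δ)`), `C_1` the loops meeting `B̄(0, 1+2δ)` and leaving `B(0,1)`, `φ_u`, `ψ_u` the disc and
ring fractions — uniformly in `r` (exit loops: `expMoment_exitCount_le_latticeEnsembles`; the two
collar sums: `φ_u ≤ min(1, diam²/r²)`, `ψ_u ≤ min(1, diam²)` and
`expMoment_collarStat_le_latticeEnsembles` at `(r − 2δ, r, r)` and `(1, 1 + 2δ, 1)`; Hölder with
weights `1/3`). -/
theorem uvCollar_expMoment_latticeEnsembles : ∀ E ∈ latticeEnsembles, ∀ a : ℝ, 0 < a → ∃ C r₀ : ℝ, 0 < r₀ ∧ ∀ r ∈ Set.Ioo (0 : ℝ) r₀, ∀ᶠ δ in 𝓝[>] (0 : ℝ), ∫ ω, Real.exp (a * ((∑ᶠ u ∈ {u ∈ (E.X δ ω).loops | (u.range ∩ Metric.closedBall (0 : ℂ) r).Nonempty ∧ ¬ u.range ⊆ Metric.ball (0 : ℂ) (r - 2 * δ)}, ∫ z in {z | u.wind z ≠ 0}, discDensity 0 r z) + ({u ∈ (E.X δ ω).loops | Metric.closedBall (0 : ℂ) r ⊆ {z | u.wind z ≠ 0} ∧ ¬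 u.range ⊆ Metric.ball (0 : ℂ) 1 ∧ (u.range ∩ Metric.closedBall (0 : ℂ) (1 + 2 * δ)).Nonempty}.ncard : ℝ) + ∑ᶠ u ∈ {u ∈ (E.X δ ω).loops | (u.range ∩ Metric.closedBall (0 : ℂ) (1 + 2 * δ)).Nonempty ∧ ¬ u.range ⊆ Metric.ball (0 : ℂ) 1}, ∫ z in {z | u.wind z ≠ 0}, annulusDensity 0 1 2 z)) ∂E.P ≤ C := by
  intro E hE a ha
  haveI := isProbabilityMeasure_of_mem hE
  have h3a : 0 < 3 * a := by positivity
  obtain ⟨C₁, c₁, hc₁, h₁⟩ := expMoment_collarStat_le_latticeEnsembles E hE (3 * a) h3a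
  obtain ⟨C₂, c₂, hc₂, h₂⟩ := expMoment_exitCount_le_latticeEnsembles E hE (3 * a) h3a
  set M : ℝ := max C₁ C₂ with hM
  refine ⟨M, 1 / 2, by norm_num, fun r hr ↦ ?_⟩
  have hr0 : 0 < r := hr.1
  filter_upwards [TowerMomentUpper.eventually_mesh_le hc₁ hr0, TowerMomentUpper.eventually_mesh_le hc₁ one_pos,
    TowerMomentUpper.eventually_mesh_le hc₂ one_pos,
    TowerMomentUpper.eventually_mesh_le (show (0 : ℝ) < 4 by norm_num) hr0] with δ hδ₁ hδ₂ hδ₃ hδ₄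
  obtain ⟨hδ, hc₁r⟩ := hδ₁
  have h4r : 4 * δ ≤ r := hδ₄.2
  have hδhalf : δ ≤ 1 / 2 := by linarith [hr.2]
  -- the three pieces
  set K₁ : E.Ω → ℝ := fun ω ↦ ∑ᶠ u ∈ {u ∈ (E.X δ ω).loops | (u.range ∩ closedBall (0 : ℂ) r).Nonempty ∧
    ¬ u.range ⊆ ball (0 : ℂ) (r - 2 * δ)}, ∫ z in {z | u.wind z ≠ 0}, discDensity 0 r z with hK₁
  set K₂ : E.Ω → ℝ := fun ω ↦ ({u ∈ (E.X δ ω).loops | closedBall (0 : ℂ) r ⊆ {z | u.wind z ≠ 0} ∧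
    ¬ u.range ⊆ ball (0 : ℂ) 1 ∧ (u.range ∩ closedBall (0 : ℂ) (1 + 2 * δ)).Nonempty}.ncard : ℝ) with hK₂
  set K₃ : E.Ω → ℝ := fun ω ↦ ∑ᶠ u ∈ {u ∈ (E.X δ ω).loops | (u.range ∩ closedBall (0 : ℂ) (1 + 2 * δ)).Nonempty ∧
    ¬ u.range ⊆ ball (0 : ℂ) 1}, ∫ z in {z | u.wind z ≠ 0}, annulusDensity 0 1 2 z with hK₃
  set S₁ : E.Ω → ℝ := fun ω ↦ ∑ᶠ u ∈ {u ∈ (E.X δ ω).loops | (u.range ∩ closedBall (0 : ℂ) r).Nonempty ∧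
    ¬ u.range ⊆ ball (0 : ℂ) (r - 2 * δ)}, min 1 (diam u.range ^ 2 / r ^ 2) with hS₁
  set S₃ : E.Ω → ℝ := fun ω ↦ ∑ᶠ u ∈ {u ∈ (E.X δ ω).loops | (u.range ∩ closedBall (0 : ℂ) (1 + 2 * δ)).Nonempty ∧
    ¬ u.range ⊆ ball (0 : ℂ) 1}, min 1 (diam u.range ^ 2 / 1 ^ 2) with hS₃
  change ∫ ω, Real.exp (a * (K₁ ω + K₂ ω + K₃ ω)) ∂E.P ≤ M
  -- their exponential moments at the order `3a`
  obtain ⟨hiS₁, hIS₁⟩ := h₁ δ (r - 2 * δ) r r hδ hc₁r (by linarith) (by linarith) (by linarith) (by linarith)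
  obtain ⟨hiS₃, hIS₃⟩ := h₁ δ 1 (1 + 2 * δ) 1 hδ hδ₂.2 one_pos (by linarith) (by linarith) (by linarith)
  obtain ⟨hiK₂, hIK₂⟩ := h₂ δ r 1 hδ hδ₃.2 hr0.le
  -- domination of the collar sums
  obtain ⟨Nδ, hNδ⟩ := FirstMoment.exists_ncard_loops_meeting_le E hE hδ 2
  have hsub₁ : ∀ ω, {u ∈ (E.X δ ω).loops | (u.range ∩ closedBall (0 : ℂ) r).Nonempty ∧
      ¬ u.range ⊆ ball (0 : ℂ) (r - 2 * δ)} ⊆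
      {u ∈ (E.X δ ω).loops | (u.range ∩ closedBall (0 : ℂ) 2).Nonempty} := by
    rintro ω u ⟨hu, ⟨x, hx, hxr⟩, -⟩
    exact ⟨hu, x, hx, closedBall_subset_closedBall (by linarith [hr.2]) hxr⟩
  have hsub₃ : ∀ ω, {u ∈ (E.X δ ω).loops | (u.range ∩ closedBall (0 : ℂ) (1 + 2 * δ)).Nonempty ∧
      ¬ u.range ⊆ ball (0 : ℂ) 1} ⊆ {u ∈ (E.X δ ω).loops | (u.range ∩ closedBall (0 : ℂ) 2).Nonempty} := by
    rintro ω u ⟨hu, ⟨x, hx, hxr⟩, -⟩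
    exact ⟨hu, x, hx, closedBall_subset_closedBall (by linarith) hxr⟩
  have hfin₁ : ∀ ω, {u ∈ (E.X δ ω).loops | (u.range ∩ closedBall (0 : ℂ) r).Nonempty ∧
      ¬ u.range ⊆ ball (0 : ℂ) (r - 2 * δ)}.Finite := fun ω ↦ (hNδ ω).1.subset (hsub₁ ω)
  have hfin₃ : ∀ ω, {u ∈ (E.X δ ω).loops | (u.range ∩ closedBall (0 : ℂ) (1 + 2 * δ)).Nonempty ∧
      ¬ u.range ⊆ ball (0 : ℂ) 1}.Finite := fun ω ↦ (hNδ ω).1.subset (hsub₃ ω)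
  have hK₁S₁ : ∀ ω, K₁ ω ≤ S₁ ω := fun ω ↦
    UVCollar.finsum_mem_le_finsum_min (hfin₁ ω) fun u hu ↦ UVCollar.discFrac_le_min u hr0 hu.2.1
  have hK₃S₃ : ∀ ω, K₃ ω ≤ S₃ ω := fun ω ↦
    UVCollar.finsum_mem_le_finsum_min (hfin₃ ω) fun u hu ↦ UVCollar.ringFrac_le_min u hu.2.1
  -- measurability and boundedness of the pieces at the fixed mesh
  have hmK₁ : Measurable K₁ := FirstMoment.measurable_finsum_loops_sep E hE δ _ _
  have hmK₂ : Measurable K₂ := measurable_from_nat.comp (BigLoops.measurable_ncard_loops_sep E hE δ _)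
  have hmK₃ : Measurable K₃ := FirstMoment.measurable_finsum_loops_sep E hE δ _ _
  have hφ1 : ∀ u : UnbasedLoop ℂ, |∫ z in {z | u.wind z ≠ 0}, discDensity 0 r z| ≤ 1 := fun u ↦ by
    have h := ConeTilt.setIntegral_discDensity_mem_Icc 0 hr0 {z | u.wind z ≠ 0}
    exact abs_le.2 ⟨by linarith [h.1], h.2⟩
  have hψ1 : ∀ u : UnbasedLoop ℂ, |∫ z in {z | u.wind z ≠ 0}, annulusDensity 0 1 2 z| ≤ 1 := fun u ↦ by
    have h := ConeTilt.setIntegral_annulusDensity_mem_Icc 0 one_pos one_lt_two {z | u.wind z ≠ 0}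
    exact abs_le.2 ⟨by linarith [h.1], h.2⟩
  have hbK₁ : ∀ ω, |K₁ ω| ≤ Nδ := fun ω ↦ by
    have h := FirstMoment.abs_finsum_mem_le (hNδ ω).1 (fun u hu ↦ hsub₁ ω hu.1) zero_le_one hφ1
    rw [one_mul] at h
    exact h.trans (by exact_mod_cast (hNδ ω).2)
  have hbK₃ : ∀ ω, |K₃ ω| ≤ Nδ := fun ω ↦ by
    have h := FirstMoment.abs_finsum_mem_le (hNδ ω).1 (fun u hu ↦ hsub₃ ω hu.1) zero_le_one hψ1
    rw [one_mul] at h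
    exact h.trans (by exact_mod_cast (hNδ ω).2)
  have hiK₁ := UVExpMoments.integrable_exp_of_abs_le E hE K₁ (3 * a) Nδ hmK₁ hbK₁
  have hiK₃ := UVExpMoments.integrable_exp_of_abs_le E hE K₃ (3 * a) Nδ hmK₃ hbK₃
  have hIK₁ : ∫ ω, Real.exp (3 * a * K₁ ω) ∂E.P ≤ M :=
    (integral_mono hiK₁ hiS₁ fun ω ↦ Real.exp_le_exp.2
      (mul_le_mul_of_nonneg_left (hK₁S₁ ω) h3a.le)).trans (hIS₁.trans (le_max_left _ _))
  have hIK₃ : ∫ ω, Real.exp (3 * a * K₃ ω) ∂E.P ≤ M :=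
    (integral_mono hiK₃ hiS₃ fun ω ↦ Real.exp_le_exp.2
      (mul_le_mul_of_nonneg_left (hK₃S₃ ω) h3a.le)).trans (hIS₃.trans (le_max_left _ _))
  have hIK₂' : ∫ ω, Real.exp (3 * a * K₂ ω) ∂E.P ≤ M := hIK₂.trans (le_max_right _ _)
  -- Hölder
  have key := UVCollar.integral_exp_add_three_le E hE (fun ω ↦ a * K₁ ω) (fun ω ↦ a * K₂ ω) (fun ω ↦ a * K₃ ω)
    (hmK₁.const_mul a) (hmK₂.const_mul a) (hmK₃.const_mul a)
    (by simp_rw [← mul_assoc]; exact hiK₁) (by simp_rw [← mul_assoc]; exact hIK₁)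
    (by simp_rw [← mul_assoc]; exact hiK₂) (by simp_rw [← mul_assoc]; exact hIK₂')
    (by simp_rw [← mul_assoc]; exact hiK₃) (by simp_rw [← mul_assoc]; exact hIK₃)
  refine le_trans (le_of_eq (integral_congr_ae (Eventually.of_forall fun ω ↦ ?_))) key
  dsimp only
  rw [mul_add, mul_add]

end Summit.CriticalPhenomena.CardyFormulaZ2.Cruxes.NestingRigidity.PositiveConeWeightDoubling

end
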